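import Mathlib
import Summits.ValiantsHypothesis.ValiantsHypothesis.Theorems.NewtonUnitEquationsTwoProductsFormalLogLinearisationDefs
import Summits.ValiantsHypothesis.ValiantsHypothesis.Theorems.NewtonUnitEquationsTwoProductsPlanarCrossCount
import Summits.ValiantsHypothesis.ValiantsHypothesis.Theorems.TwoProducts.Negative.RowCoincidenceThreeDigitBox
import HarnessLib

/-!
# A fourth exception to box row-coincidence: the second variation with antipodal weights (`m = 4`)

Negative lane, `--supports stmt-ValiantsHypothesis-5906` (route `NewtonUnitEquations`, crux `TwoProducts`, line
`relation_ladder`; ideas `subbox-congruence-cascade`, `first-variation-resolvent`). No summit statement is proved here.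
The witness is val-idea-crit-8 g3's «SV» (bus 2026-08-29T03:30:41Z, exact); this file is its kernel record.

With `a := X^(2,4)`, `b := X^(4,2)`, `T := X^(64,1)` (all on the digit grid `A_7`) and the weights `τ = (1,−1,i,−i)`
(`Σ τ_j = 0` on each pair AND `e₂(τ) = 0`):

  `1 + u = (1+a, 1+a, 1+b, 1+b)`,  `1 + v = (1+a+T, 1+a−T, 1+b+iT, 1+b−iT)`,
  `∏(1+v) = ((1+a)² − T²)((1+b)² + T²)`, so
  `D = ∏(1+u) − ∏(1+v) = T²(b−a)(2+a+b) + T⁴ = −2X^(130,6) + 2X^(132,4) − X^(132,10) + X^(136,6) + X^(256,4)`.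

At the LL-visible point `p = (132,4) = 2T + b` (weight `ξ = (−1,−10)`) the rows truncated to the box `[0,132)×[0,4)`
are `{0, 0, b, b}` versus `{T, −T, b+iT, b−iT}` — NOT equal as multisets — and the half point `p/2 = (66,2)` is in no
row: a second, independent failure (after `ExceptionalCornerNoHalfLetter`, `m = 3`) of the half-letter charging law,
here stated for four-row instances, by a different mechanism (first variation vanishes identically, second variation
has no constant term). [folklore]
-/

set_option linter.dupNamespace false

open scoped BigOperators
open MvPolynomial
open Summit.ValiantsHypothesis.ValiantsHypothesis.Theorems.NewtonUnitEquations.TwoProducts.FormalLogLinearisation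
open Summit.ValiantsHypothesis.ValiantsHypothesis.Theorems.NewtonUnitEquations.TwoProducts.PlanarCell (tailSupport)
open Summit.ValiantsHypothesis.ValiantsHypothesis.Theorems.NewtonUnitEquations.TwoProducts.Negative.RowCoincidence

namespace Summit.ValiantsHypothesis.ValiantsHypothesis.Theorems.NewtonUnitEquations.TwoProducts.Negative.SecondVariation

noncomputable section

/-- the letter `a = (2,4)`. -/
def la : Expo := Finsupp.single 0 2 + Finsupp.single 1 4
/-- the letter `b = (4,2)`. -/
def lb : Expo := Finsupp.single 0 4 + Finsupp.single 1 2
/-- the letter `T = (64,1) = (2⁶,2⁰)`. -/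
def lt : Expo := Finsupp.single 0 64 + Finsupp.single 1 1
/-- the half point `h = (66,2)`. -/
def hh : Expo := Finsupp.single 0 66 + Finsupp.single 1 2
/-- the LL-visible point `p = (132,4) = 2T + b = h + h`. -/
def qq : Expo := hh + hh
/-- support points of `D`. -/
def e1306 : Expo := Finsupp.single 0 130 + Finsupp.single 1 6
/-- a support point of `D`. -/
def e13210 : Expo := Finsupp.single 0 132 + Finsupp.single 1 10
/-- a support point of `D`. -/
def e1366 : Expo := Finsupp.single 0 136 + Finsupp.single 1 6
/-- a support point of `D`. -/
def e2564 : Expo := Finsupp.single 0 256 + Finsupp.single 1 4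

/-- coordinate evaluation. -/
@[simp] theorem qq_zero : qq 0 = 132 := by simp [qq, hh]
/-- coordinate evaluation. -/
@[simp] theorem qq_one : qq 1 = 4 := by simp [qq, hh]
/-- the point in `single` form. -/
theorem qq_eq : qq = Finsupp.single 0 132 + Finsupp.single 1 4 := by ext i; fin_cases i <;> simp [qq, hh]

/-- distinctness of two exponents. -/
theorem la_ne_lb : la ≠ lb := fun h => by have := congrArg (· 0) h; simp [la, lb] at this
/-- distinctness of two exponents. -/
theorem la_ne_lt : la ≠ lt := fun h => by have := congrArg (· 0) h; simp [la, lt] at this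
/-- distinctness of two exponents. -/
theorem lb_ne_lt : lb ≠ lt := fun h => by have := congrArg (· 0) h; simp [lb, lt] at this
/-- distinctness of two exponents. -/
theorem hh_ne_la : hh ≠ la := fun h => by have := congrArg (· 0) h; simp [hh, la] at this
/-- distinctness of two exponents. -/
theorem hh_ne_lb : hh ≠ lb := fun h => by have := congrArg (· 0) h; simp [hh, lb] at this
/-- distinctness of two exponents. -/
theorem hh_ne_lt : hh ≠ lt := fun h => by have := congrArg (· 0) h; simp [hh, lt] at this
/-- distinctness of two exponents. -/
theorem qq_ne_e1306 : qq ≠ e1306 := fun h => by have := congrArg (· 0) h; simp [qq, hh, e1306] at this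
/-- distinctness of two exponents. -/
theorem qq_ne_e13210 : qq ≠ e13210 := fun h => by have := congrArg (· 1) h; simp [qq, hh, e13210] at this
/-- distinctness of two exponents. -/
theorem qq_ne_e1366 : qq ≠ e1366 := fun h => by have := congrArg (· 0) h; simp [qq, hh, e1366] at this
/-- distinctness of two exponents. -/
theorem qq_ne_e2564 : qq ≠ e2564 := fun h => by have := congrArg (· 0) h; simp [qq, hh, e2564] at this

/-- A row `x·a + y·b + z·T`. -/
def srow (x y z : ℂ) : MvPolynomial (Fin 2) ℂ := monomial la x + monomial lb y + monomial lt z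

/-- Coefficients of a row. -/
theorem coeff_srow (x y z : ℂ) (e : Expo) :
    coeff e (srow x y z) = (if la = e then x else 0) + (if lb = e then y else 0) + (if lt = e then z else 0) := by
  simp [srow, coeff_monomial]

/-- `coeff T`. -/
@[simp] theorem coeff_srow_lt (x y z : ℂ) : coeff lt (srow x y z) = z := by
  simp [coeff_srow, la_ne_lt, lb_ne_lt]
/-- `coeff h = 0`: the half point is in no row. -/
@[simp] theorem coeff_srow_hh (x y z : ℂ) : coeff hh (srow x y z) = 0 := by
  simp [coeff_srow, hh_ne_la.symm, hh_ne_lb.symm, hh_ne_lt.symm]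

/-- A row in `C · X₀^i X₁^k` form (for `ring`). -/
theorem srow_eq (x y z : ℂ) :
    srow x y z = C x * X 0 ^ 2 * X 1 ^ 4 + C y * X 0 ^ 4 * X 1 ^ 2 + C z * X 0 ^ 64 * X 1 ^ 1 := by
  rw [C_mul_X_eq, C_mul_X_eq, C_mul_X_eq]; rfl

/-- f-tails `u = (a, a, b, b)`. -/
def fu : Fin 4 → MvPolynomial (Fin 2) ℂ := ![srow 1 0 0, srow 1 0 0, srow 0 1 0, srow 0 1 0]

/-- g-tails `v = (a + T, a − T, b + iT, b − iT)`. -/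
def fv : Fin 4 → MvPolynomial (Fin 2) ℂ :=
  ![srow 1 0 1, srow 1 0 (-1), srow 0 1 Complex.I, srow 0 1 (-Complex.I)]

/-- `C i * C i = −1` in the polynomial ring. -/
theorem C_I_mul_C_I : (C Complex.I : MvPolynomial (Fin 2) ℂ) * C Complex.I = -1 := by
  rw [← map_mul, Complex.I_mul_I, map_neg, map_one]

/-- The tail difference: `D = −2X^(130,6) + 2X^(132,4) − X^(132,10) + X^(136,6) + X^(256,4)`. -/
theorem tailDiff_eq :
    tailDiff fu fv = monomial e1306 (-2) + monomial qq 2 + monomial e13210 (-1) + monomial e1366 1 + monomial e2564 1 := by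
  have h1 : (monomial e1306 (-2 : ℂ) : MvPolynomial (Fin 2) ℂ) = C (-2) * X 0 ^ 130 * X 1 ^ 6 := by rw [C_mul_X_eq]; rfl
  have h2 : (monomial qq (2 : ℂ) : MvPolynomial (Fin 2) ℂ) = C 2 * X 0 ^ 132 * X 1 ^ 4 := by rw [C_mul_X_eq, qq_eq]
  have h3 : (monomial e13210 (-1 : ℂ) : MvPolynomial (Fin 2) ℂ) = C (-1) * X 0 ^ 132 * X 1 ^ 10 := by rw [C_mul_X_eq]; rfl
  have h4 : (monomial e1366 (1 : ℂ) : MvPolynomial (Fin 2) ℂ) = C 1 * X 0 ^ 136 * X 1 ^ 6 := by rw [C_mul_X_eq]; rfl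
  have h5 : (monomial e2564 (1 : ℂ) : MvPolynomial (Fin 2) ℂ) = C 1 * X 0 ^ 256 * X 1 ^ 4 := by rw [C_mul_X_eq]; rfl
  simp only [tailDiff, fu, fv, Fin.prod_univ_four, Matrix.cons_val_zero, Matrix.cons_val_one, Matrix.cons_val]
  rw [h1, h2, h3, h4, h5, srow_eq, srow_eq, srow_eq, srow_eq, srow_eq, srow_eq]
  simp only [map_neg, map_one, map_zero, map_ofNat]
  linear_combination ((1 + X 0 ^ 2 * X 1 ^ 4) ^ 2 - (X 0 ^ 64 * X 1 ^ 1) ^ 2) * (X 0 ^ 64 * X 1 ^ 1) ^ 2 * C_I_mul_C_I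

/-- Coefficients of the tail difference. -/
theorem coeff_tailDiff (x : Expo) :
    coeff x (tailDiff fu fv) = (if e1306 = x then (-2 : ℂ) else 0) + (if qq = x then 2 else 0) +
      (if e13210 = x then -1 else 0) + (if e1366 = x then 1 else 0) + (if e2564 = x then 1 else 0) := by
  rw [tailDiff_eq]; simp only [coeff_add, coeff_monomial]

/-- The support of the tail difference is inside the five points. -/
theorem mem_support_tailDiff {x : Expo} (hx : x ∈ (tailDiff fu fv).support) :
    x = e1306 ∨ x = qq ∨ x = e13210 ∨ x = e1366 ∨ x = e2564 := by
  rw [mem_support_iff, coeff_tailDiff] at hx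
  by_contra h
  push Not at h
  apply hx
  simp [Ne.symm h.1, Ne.symm h.2.1, Ne.symm h.2.2.1, Ne.symm h.2.2.2.1, Ne.symm h.2.2.2.2]

/-- `p = (132,4)` is in the support (coefficient `2`). -/
theorem qq_mem_support : qq ∈ (tailDiff fu fv).support := by
  rw [mem_support_iff, coeff_tailDiff]
  simp [qq_ne_e1306.symm, qq_ne_e13210.symm, qq_ne_e1366.symm, qq_ne_e2564.symm]

/-- Support of a row. -/
theorem mem_support_srow {x y z : ℂ} {e : Expo} (he : e ∈ (srow x y z).support) : e = la ∨ e = lb ∨ e = lt := by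
  rw [mem_support_iff, coeff_srow] at he
  by_contra h
  push Not at h
  apply he
  simp [Ne.symm h.1, Ne.symm h.2.1, Ne.symm h.2.2]

/-- The weight `ξ = (−1, −10)`. -/
def xi3 : Fin 2 → ℝ := ![-1, -10]

/-- coordinate evaluation. -/
@[simp] theorem xi3_zero : xi3 0 = -1 := rfl
/-- coordinate evaluation. -/
@[simp] theorem xi3_one : xi3 1 = -10 := rfl

/-- `wt ξ e = −(e₀ + 10 e₁)`. -/
theorem wt_xi3 (e : Expo) : wt xi3 e = -(((e 0 : ℕ) : ℝ) + 10 * ((e 1 : ℕ) : ℝ)) := by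
  unfold wt; simp; ring

/-- Every exponent of a row has negative weight. -/
theorem wt_srow_neg {x y z : ℂ} {e : Expo} (he : e ∈ (srow x y z).support) : wt xi3 e < 0 := by
  rcases mem_support_srow he with rfl | rfl | rfl <;> (rw [wt_xi3]; norm_num [la, lb, lt])

/-- `ξ` is a valid weight for the instance. -/
theorem validWeight_xi3 : ValidWeight fu fv xi3 := by
  refine ⟨fun j e he => ?_, fun j e he => ?_⟩ <;> fin_cases j <;> exact wt_srow_neg (by simpa [fu, fv] using he)

/-- `p = (132,4)` is the strict `ξ`-top of the support: `−172 > −190, −232, −196, −296`. -/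
theorem isStrictTop_qq : IsStrictTop xi3 (↑(tailDiff fu fv).support : Set Expo) qq := by
  refine ⟨by exact_mod_cast qq_mem_support, fun μ hμ hne => ?_⟩
  rcases mem_support_tailDiff (by exact_mod_cast hμ) with rfl | rfl | rfl | rfl | rfl
  · rw [wt_xi3, wt_xi3]; norm_num [e1306, qq, hh]
  · exact absurd rfl hne
  · rw [wt_xi3, wt_xi3]; norm_num [e13210, qq, hh]
  · rw [wt_xi3, wt_xi3]; norm_num [e1366, qq, hh]
  · rw [wt_xi3, wt_xi3]; norm_num [e2564, qq, hh]

/-- `p = (132,4)` is LL-visible. -/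
theorem qq_mem_llVisible : qq ∈ llVisible fu fv :=
  ⟨xi3, by simp, by simp, validWeight_xi3, isStrictTop_qq⟩

/-- Truncation of a row to the box `[0,132)×[0,4)` below `p` cuts the letter `a = (2,4)` (`a₁ = 4 ≥ 4`) and keeps
`b = (4,2)` and `T = (64,1)`. -/
theorem boxTrunc_srow (x y z : ℂ) : boxTrunc 132 4 (srow x y z) = srow 0 y z := by
  ext e
  rw [coeff_boxTrunc, coeff_srow, coeff_srow]
  by_cases h1 : la = e
  · subst h1
    have hla : ¬ ((la 0 : ℕ) < 132 ∧ (la 1 : ℕ) < 4) := by simp [la]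
    simp [hla, Ne.symm la_ne_lb, Ne.symm la_ne_lt]
  by_cases h2 : lb = e
  · subst h2
    have hlb : ((lb 0 : ℕ) < 132 ∧ (lb 1 : ℕ) < 4) := by simp [lb]
    simp [hlb, la_ne_lb, Ne.symm lb_ne_lt]
  by_cases h3 : lt = e
  · subst h3
    have hlt : ((lt 0 : ℕ) < 132 ∧ (lt 1 : ℕ) < 4) := by simp [lt]
    simp [hlt, la_ne_lt, lb_ne_lt]
  simp [h1, h2, h3]

/-- The truncated first `u`-row is `0`. -/
theorem boxTrunc_fu0 : boxTrunc 132 4 (fu 0) = 0 := by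
  simp only [fu, Matrix.cons_val_zero, boxTrunc_srow]
  simp [srow]

/-- Every truncated `v`-row has a nonzero `T`-coefficient, so it is not `0`. -/
theorem boxTrunc_fv_ne_zero : ∀ j, boxTrunc 132 4 (fv j) ≠ 0 := by
  intro j hj
  have hc := congrArg (coeff lt) hj
  fin_cases j <;> simp [fv, boxTrunc_srow, Complex.I_ne_zero] at hc

/-- The truncated rows of the two sides are NOT equal as multisets (box-coincidence fails at `p`). -/
theorem truncated_rows_ne :
    (Finset.univ.val.map fun j => boxTrunc 132 4 (fu j)) ≠ (Finset.univ.val.map fun j => boxTrunc 132 4 (fv j)) := by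
  intro h
  have hmem : boxTrunc 132 4 (fu 0) ∈ (Finset.univ.val.map fun j => boxTrunc 132 4 (fv j)) := by
    rw [← h]; exact Multiset.mem_map.2 ⟨0, Finset.mem_univ_val 0, rfl⟩
  obtain ⟨j, -, hj⟩ := Multiset.mem_map.1 hmem
  rw [boxTrunc_fu0] at hj
  exact boxTrunc_fv_ne_zero j hj

/-- The half point `h = (66,2)` has coefficient `0` in every row. -/
theorem coeff_hh_rows : ∀ j, coeff hh (fu j) = 0 ∧ coeff hh (fv j) = 0 := by
  intro j; fin_cases j <;> simp [fu, fv]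

/-- The half point is NOT a tail letter of the instance. -/
theorem half_notMem_tailSupport : hh ∉ tailSupport fu fv := by
  intro h
  unfold tailSupport at h
  rcases Finset.mem_union.1 h with h | h <;> obtain ⟨j, -, hj⟩ := Finset.mem_biUnion.1 h <;>
    rw [mem_support_iff] at hj
  · exact hj (coeff_hh_rows j).1
  · exact hj (coeff_hh_rows j).2

/-- digit-grid membership. -/
theorem la_mem_digitGrid : la ∈ DigitGrid 7 := ⟨1, 2, by norm_num, by norm_num, by simp [la], by simp [la]⟩
/-- digit-grid membership. -/
theorem lb_mem_digitGrid : lb ∈ DigitGrid 7 := ⟨2, 1, by norm_num, by norm_num, by simp [lb], by simp [lb]⟩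
/-- digit-grid membership. -/
theorem lt_mem_digitGrid : lt ∈ DigitGrid 7 := ⟨6, 0, by norm_num, by norm_num, by simp [lt], by simp [lt]⟩

/-- Rows are supported on the digit grid `A_7`. -/
theorem srow_support_digitGrid {x y z : ℂ} : ∀ e ∈ (srow x y z).support, e ∈ DigitGrid 7 := by
  intro e he
  rcases mem_support_srow he with rfl | rfl | rfl
  exacts [la_mem_digitGrid, lb_mem_digitGrid, lt_mem_digitGrid]

/-- digit-grid membership. -/
theorem fu_digitGrid : ∀ j, ∀ e ∈ (fu j).support, e ∈ DigitGrid 7 := by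
  intro j; fin_cases j <;> exact srow_support_digitGrid

/-- digit-grid membership. -/
theorem fv_digitGrid : ∀ j, ∀ e ∈ (fv j).support, e ∈ DigitGrid 7 := by
  intro j; fin_cases j <;> exact srow_support_digitGrid

/-- **The SV witness, packaged** (`m = 4`, `s = 7`). -/
theorem secondVariation_witness :
    (∀ j, ∀ e ∈ (fu j).support, e ∈ DigitGrid 7) ∧ (∀ j, ∀ e ∈ (fv j).support, e ∈ DigitGrid 7) ∧
    qq ∈ llVisible fu fv ∧ qq = hh + hh ∧
    (Finset.univ.val.map fun j => boxTrunc (qq 0) (qq 1) (fu j)) ≠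
      (Finset.univ.val.map fun j => boxTrunc (qq 0) (qq 1) (fv j)) ∧
    hh ∉ tailSupport fu fv := by
  refine ⟨fu_digitGrid, fv_digitGrid, qq_mem_llVisible, rfl, ?_, half_notMem_tailSupport⟩
  rw [qq_zero, qq_one]; exact truncated_rows_ne

/-- **The half-letter charging law fails among four-row instances** (`m = 4` fixed; independent mechanism — the
statement for all `m` is refuted at `m = 3` by `NoHalfLetter.not_halfLetter_of_exceptional_corner`). -/
theorem not_halfLetter_of_exceptional_corner_four :
    ¬ (∀ (s : ℕ) (u v : Fin 4 → MvPolynomial (Fin 2) ℂ),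
        (∀ j, ∀ e ∈ (u j).support, e ∈ DigitGrid s) → (∀ j, ∀ e ∈ (v j).support, e ∈ DigitGrid s) →
        ∀ p ∈ llVisible u v, ∀ h : Expo, p = h + h →
          (Finset.univ.val.map fun j => boxTrunc (p 0) (p 1) (u j)) ≠
            (Finset.univ.val.map fun j => boxTrunc (p 0) (p 1) (v j)) →
          h ∈ tailSupport u v) := by
  intro H
  obtain ⟨hu, hv, hvis, hqq, hne, hnot⟩ := secondVariation_witness
  exact hnot (H 7 fu fv hu hv qq hvis hh hqq hne)

end

end Summit.ValiantsHypothesis.ValiantsHypothesis.Theorems.NewtonUnitEquations.TwoProducts.Negative.SecondVariation
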